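import Mathlib.Geometry.Manifold.SmoothApprox
import Mathlib.Geometry.Manifold.PartitionOfUnity
import Mathlib.Geometry.Manifold.ContMDiff.Atlas
import Mathlib.Geometry.Manifold.ContMDiff.NormedSpace
import Mathlib.Geometry.Manifold.Instances.Real
import Mathlib.Topology.MetricSpace.Thickening
import Mathlib.Topology.Homotopy.Basic
import HarnessLib

/-!
# Smoothing a map into a manifold chart by chart (rel a closed set, with open constraints);
# smoothing a homotopy into a non-compact manifold rel ends

Topic `Literature/Topology/FourManifolds`; general infrastructure (companion of
`HomotopySmoothing.lean` and `MapSmoothing.lean`, which embed a *compact* target in Euclidean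
space and retract).  Here the target `N` is an arbitrary `C^∞` manifold modelled on `ℝⁿ` (not
necessarily compact, no Whitney embedding, no tubular neighbourhood): the smoothing is done one
chart of `N` at a time over a finite cover of a compact set of the source, by the classical
relative approximation in coordinates (Milnor, *Lectures on the h-cobordism theorem* (1965),
Lemma 6.11: *a continuous map of smooth manifolds, smooth on a closed subset `A`, is homotopic
rel `A` to a smooth map*; Hirsch, *Differential Topology* (1976), Ch. 2 §2, Thm. 2.6).  It is the
smoothing half of the tree's proof of Milnor's Thm. 8.4 / Whitney's theorem *homotopic smooth
embeddings `Mᵐ → Nⁿ` of a compact manifold are smoothly isotopic when `n ≥ 2m + 2`*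
(`Literature.Topology.FourManifolds.Milnor1965_isSmoothlyIsotopic_of_homotopic`,
`HomotopicEmbeddingsIsotopic.lean`).

* `Literature.Topology.FourManifolds.exists_pos_forall_chart_add_mem` — margin lemma: small
  translates, in a chart of `N`, of the image of a compact set stay in a given open set.
* `Literature.Topology.FourManifolds.exists_smoothing_step` — **one chart**: `H : P → N`
  continuous, `C^∞` on an open `O ⊇ S` (`S` closed), `K` compact and mapped into the source of
  the chart at `x`; then some continuous `H'` agrees with `H` on `S`, is `C^∞` on an open set
  containing `S ∪ K`, and still maps finitely many given compact sets `C i` into open sets `U i`.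
  Construction: with `ψ` the extended chart at `x`, cut `ψ ∘ H` off to a global continuous
  `ū = χ • (ψ ∘ H)`, approximate it by a smooth `s̄` with `s̄ = ū` on `S` (Mathlib's
  `Continuous.exists_contMDiff_approx_and_eqOn`, smooth partitions of unity on the source), and
  move `H` inside the chart by the displacement `λ • (s̄ - ū)` (`λ = 1` near `K`), small enough
  for all margins.
* `Literature.Topology.FourManifolds.exists_contMDiffOn_of_isCompact` — **finitely many charts**:
  the same with `K` an arbitrary compact set (induction over a finite cover of `K` by compact
  neighbourhoods mapped into chart sources, the chart constraints of the later pieces being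
  carried along as constraints `C i ↦ U i`).
* `Literature.Topology.FourManifolds.exists_contMDiff_homotopy_of_homotopic_chartwise` —
  **smoothing a homotopy rel ends**: `M` compact Hausdorff, `N` any `C^∞` manifold modelled on
  `ℝⁿ`, `e₀ e₁ : C(M, N)` smooth and homotopic; then there is a smooth `H : ℝ × M → N` with
  `H (t, ·) = e₀` for `t ≤ 1/4` and `H (t, ·) = e₁` for `t ≥ 3/4` (the statement of the tree's
  `exists_contMDiff_homotopy_of_homotopic` without compactness of the target).

Everything here is proved; no definitions, no named facts.

## References

* J. Milnor, *Lectures on the h-cobordism theorem*, notes by L. Siebenmann and J. Sondow,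
  Princeton (1965), Lemma 6.11 (PDF p. 42 of the held copy), Thm. 8.4 (PDF p. 56).
  [MilnorHCobordism1965]
* M. W. Hirsch, *Differential Topology*, GTM 33 (1976), Ch. 2 §2 (Thm. 2.6, relative
  approximation). [HirschDT1976]
-/

open scoped Manifold ContDiff Topology
open Function Set Filter

noncomputable section

namespace Literature.Topology.FourManifolds

variable {n : ℕ} {N : Type*} [TopologicalSpace N] [ChartedSpace (EuclideanSpace ℝ (Fin n)) N]

/-! ### Margins in a chart -/

section Margin

/-- **Margin lemma.**  If `H : P → N` is continuous and maps the compact set `C` into the source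
of the chart at `x`, and the chart images `ψ (H '' C)` lie in the open set `O ⊆ ℝⁿ`, then all
translates `ψ (H p) + y` with `‖y‖ ≤ ε`, `p ∈ C`, still lie in `O`, for some `ε > 0`
(`IsCompact.exists_cthickening_subset_open`). [folklore] -/
theorem exists_pos_forall_chart_add_mem {P : Type*} [TopologicalSpace P] {H : P → N}
    (hH : Continuous H) {x : N} {C : Set P} (hC : IsCompact C)
    (hsrc : MapsTo H C (chartAt (EuclideanSpace ℝ (Fin n)) x).source)
    {O : Set (EuclideanSpace ℝ (Fin n))} (hO : IsOpen O)
    (hCO : ∀ p ∈ C, extChartAt (𝓡 n) x (H p) ∈ O) :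
    ∃ ε : ℝ, 0 < ε ∧ ∀ p ∈ C, ∀ y : EuclideanSpace ℝ (Fin n), ‖y‖ ≤ ε →
      extChartAt (𝓡 n) x (H p) + y ∈ O := by
  set S : Set (EuclideanSpace ℝ (Fin n)) := (fun p => extChartAt (𝓡 n) x (H p)) '' C with hS
  have hcont : ContinuousOn (fun p => extChartAt (𝓡 n) x (H p)) C := by
    refine (continuousOn_extChartAt x).comp hH.continuousOn ?_
    intro p hp
    rw [extChartAt_source]
    exact hsrc hp
  have hSc : IsCompact S := hC.image_of_continuousOn hcont
  have hSO : S ⊆ O := by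
    rintro _ ⟨p, hp, rfl⟩
    exact hCO p hp
  obtain ⟨ε, hε, hεO⟩ := hSc.exists_cthickening_subset_open hO hSO
  refine ⟨ε, hε, fun p hp y hy => hεO ?_⟩
  refine Metric.mem_cthickening_of_dist_le _ (extChartAt (𝓡 n) x (H p)) _ _ ⟨p, hp, rfl⟩ ?_
  simpa [dist_eq_norm] using hy

/-- **Common margin.**  Finitely many positive margins `εᵢ` and one more `ε₀` have a common
positive lower bound `ε`. [folklore] -/
theorem exists_pos_le_forall {ι : Type*} [Finite ι] {ε₀ : ℝ} (hε₀ : 0 < ε₀) {εi : ι → ℝ}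
    (hεi : ∀ i, 0 < εi i) : ∃ ε : ℝ, 0 < ε ∧ ε ≤ ε₀ ∧ ∀ i, ε ≤ εi i := by
  have h1 : ∀ᶠ ε in 𝓝[>] (0 : ℝ), ε ≤ ε₀ := by
    filter_upwards [Ioc_mem_nhdsGT hε₀] with ε hε using hε.2
  have h2 : ∀ᶠ ε in 𝓝[>] (0 : ℝ), ∀ i, ε ≤ εi i :=
    eventually_all.2 fun i => by
      filter_upwards [Ioc_mem_nhdsGT (hεi i)] with ε hε using hε.2
  obtain ⟨ε, ⟨hε1, hε2⟩, hεpos⟩ := ((h1.and h2).and self_mem_nhdsWithin).exists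
  exact ⟨ε, hεpos, hε1, hε2⟩

end Margin

/-! ### One chart: relative smoothing with constraints -/

section Step

variable [IsManifold (𝓡 n) ∞ N]
  {EP HP : Type*} [NormedAddCommGroup EP] [NormedSpace ℝ EP] [FiniteDimensional ℝ EP]
  [TopologicalSpace HP] {IP : ModelWithCorners ℝ EP HP}
  {P : Type*} [TopologicalSpace P] [ChartedSpace HP P] [IsManifold IP ∞ P]
  [SigmaCompactSpace P] [T2Space P]

/-- **Relative smoothing in one chart of the target** (Milnor (1965), Lemma 6.11; Hirsch (1976),
Ch. 2 Thm. 2.6, one step of the induction).  Let `H : P → N` be continuous, `C^∞` on an open set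
`O` containing the closed set `S`, let the compact set `K` be mapped by `H` into the source of the
chart of `N` at `x`, and let finitely many compact sets `C i` be mapped into open sets `U i`.
Then there is a continuous `H' : P → N`, `C^∞` on an open set containing `S ∪ K`, equal to `H`
on `S`, and still mapping each `C i` into `U i`.  (In the extended chart `ψ` at `x`: cut
`ψ ∘ H` off to a global continuous map `ū`, approximate `ū` by a smooth `s̄` equal to `ū` on `S`,
and replace `H` by `ψ⁻¹ (ψ ∘ H + λ • (s̄ - ū))` with a bump `λ = 1` near `K`; where `λ = 1` this
is `ψ⁻¹ ∘ s̄`.) [cite: MilnorHCobordism1965, Lemma 6.11 (PDF p. 42)] -/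
theorem exists_smoothing_step {H : P → N} (hH : Continuous H) {O : Set P} (hO : IsOpen O)
    (hHO : ContMDiffOn IP (𝓡 n) ∞ H O) {S : Set P} (hS : IsClosed S) (hSO : S ⊆ O)
    {K : Set P} (hK : IsCompact K) {x : N}
    (hKx : MapsTo H K (chartAt (EuclideanSpace ℝ (Fin n)) x).source)
    {ι : Type*} [Finite ι] {C : ι → Set P} {U : ι → Set N} (hC : ∀ i, IsCompact (C i))
    (hU : ∀ i, IsOpen (U i)) (hCU : ∀ i, MapsTo H (C i) (U i)) :
    ∃ H' : P → N, Continuous H' ∧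
      (∃ O' : Set P, IsOpen O' ∧ S ∪ K ⊆ O' ∧ ContMDiffOn IP (𝓡 n) ∞ H' O') ∧
      EqOn H' H S ∧ ∀ i, MapsTo H' (C i) (U i) := by
  classical
  haveI : LocallyCompactSpace P := Manifold.locallyCompact_of_finiteDimensional IP
  set ψ := extChartAt (𝓡 n) x with hψ
  set W : Set P := H ⁻¹' (chartAt (EuclideanSpace ℝ (Fin n)) x).source with hW
  have hWo : IsOpen W := (chartAt (EuclideanSpace ℝ (Fin n)) x).open_source.preimage hH
  have hKW : K ⊆ W := fun p hp => hKx hp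
  have hWsrc : ∀ p ∈ W, H p ∈ ψ.source := fun p hp => by
    rw [hψ, extChartAt_source]
    exact hp
  -- ### compact neighbourhoods `K ⊆ L₁° ⊆ L₁ ⊆ L₂° ⊆ L₂ ⊆ L₃° ⊆ L₃ ⊆ W`
  obtain ⟨L₁, hL₁c, hKL₁, hL₁W⟩ := exists_compact_between hK hWo hKW
  obtain ⟨L₂, hL₂c, hL₁L₂, hL₂W⟩ := exists_compact_between hL₁c hWo hL₁W
  obtain ⟨L₃, hL₃c, hL₂L₃, hL₃W⟩ := exists_compact_between hL₂c hWo hL₂W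
  -- ### the blend weight `lam` (`= 1` on `L₁`, `= 0` off `L₂°`) and the cut-off `chi`
  -- (`= 1` on `L₂`, `= 0` off `L₃°`)
  obtain ⟨lam, hlam0, hlam1, hlam01⟩ := exists_contMDiffMap_zero_one_of_isClosed IP
    (isOpen_interior (s := L₂)).isClosed_compl hL₁c.isClosed
    (disjoint_compl_left_iff_subset.2 hL₁L₂) (n := ⊤)
  obtain ⟨chi, hchi0, hchi1, hchi01⟩ := exists_contMDiffMap_zero_one_of_isClosed IP
    (isOpen_interior (s := L₃)).isClosed_compl hL₂c.isClosed
    (disjoint_compl_left_iff_subset.2 hL₂L₃) (n := ⊤)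
  have hlam_supp : ∀ p, lam p ≠ 0 → p ∈ interior L₂ := fun p hp => by
    by_contra h
    exact hp (hlam0 h)
  have htsupp_lam : tsupport lam ⊆ L₂ :=
    closure_minimal (fun p hp => interior_subset (hlam_supp p hp)) hL₂c.isClosed
  have hchi_supp : ∀ p, chi p ≠ 0 → p ∈ interior L₃ := fun p hp => by
    by_contra h
    exact hp (hchi0 h)
  have htsupp_chi : tsupport chi ⊆ L₃ :=
    closure_minimal (fun p hp => interior_subset (hchi_supp p hp)) hL₃c.isClosed
  -- ### the cut-off coordinate function `ub = chi • (ψ ∘ H)`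
  set ub : P → EuclideanSpace ℝ (Fin n) := fun p => chi p • ψ (H p) with hub
  have hub_zero : ∀ p, p ∉ tsupport chi → ub =ᶠ[𝓝 p] fun _ => 0 := fun p hp => by
    filter_upwards [notMem_tsupport_iff_eventuallyEq.1 hp] with p' hp'
    simp only [hub, Pi.zero_apply] at hp' ⊢
    rw [hp', zero_smul]
  have hψH_cont : ∀ p ∈ W, ContinuousAt (fun p => ψ (H p)) p := fun p hp =>
    (continuousAt_extChartAt' (I := 𝓡 n) (hWsrc p hp)).comp hH.continuousAt
  have hubc : Continuous ub := by
    rw [continuous_iff_continuousAt]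
    intro p
    by_cases hp : p ∈ W
    · exact chi.contMDiff.continuous.continuousAt.smul (hψH_cont p hp)
    · have hp' : p ∉ tsupport chi := fun h => hp (hL₃W (htsupp_chi h))
      exact (continuousAt_congr (hub_zero p hp')).2 continuousAt_const
  have hψH_smooth : ∀ p ∈ O ∩ W,
      ContMDiffAt IP 𝓘(ℝ, EuclideanSpace ℝ (Fin n)) ∞ (fun p => ψ (H p)) p := fun p hp =>
    (contMDiffAt_extChartAt' (I := 𝓡 n) hp.2).comp p (hHO.contMDiffAt (hO.mem_nhds hp.1))
  have hubO : ContMDiffOn IP 𝓘(ℝ, EuclideanSpace ℝ (Fin n)) ∞ ub O := by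
    intro p hpO
    by_cases hp : p ∈ W
    · exact (chi.contMDiff.contMDiffAt.smul (hψH_smooth p ⟨hpO, hp⟩)).contMDiffWithinAt
    · have hp' : p ∉ tsupport chi := fun h => hp (hL₃W (htsupp_chi h))
      exact (contMDiffAt_const.congr_of_eventuallyEq (hub_zero p hp')).contMDiffWithinAt
  -- ### margins
  obtain ⟨ε₀, hε₀, hε₀P⟩ := exists_pos_forall_chart_add_mem hH hL₂c (fun p hp => hL₂W hp)
    (isOpen_extChartAt_target (I := 𝓡 n) x) fun p hp => ψ.map_source (hWsrc p (hL₂W hp))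
  have hεi : ∀ i, ∃ ε : ℝ, 0 < ε ∧ ∀ p ∈ C i ∩ L₂, ∀ y : EuclideanSpace ℝ (Fin n), ‖y‖ ≤ ε →
      ψ (H p) + y ∈ ψ.target ∩ ψ.symm ⁻¹' U i := by
    intro i
    refine exists_pos_forall_chart_add_mem hH ((hC i).inter_right hL₂c.isClosed)
      (fun p hp => hL₂W hp.2)
      ((continuousOn_extChartAt_symm x).isOpen_inter_preimage (isOpen_extChartAt_target x)
        (hU i)) fun p hp => ⟨ψ.map_source (hWsrc p (hL₂W hp.2)), ?_⟩
    rw [mem_preimage, ψ.left_inv (hWsrc p (hL₂W hp.2))]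
    exact hCU i hp.1
  choose εi hεi_pos hεiP using hεi
  obtain ⟨ε, hεpos, hεle0, hεlei⟩ := exists_pos_le_forall hε₀ hεi_pos
  -- ### smooth approximation of `ub`, equal to `ub` on `S`
  obtain ⟨sb, hsb, hsbS, -⟩ := hubc.exists_contMDiff_approx_and_eqOn IP ⊤ continuous_const
    (fun _ => hεpos) hS (hO.mem_nhdsSet.2 hSO) hubO
  -- ### the displacement `d = lam • (sb - ub)`
  set d : P → EuclideanSpace ℝ (Fin n) := fun p => lam p • (sb p - ub p) with hd
  have hd_norm : ∀ p, ‖d p‖ ≤ ε := fun p => by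
    have h1 : ‖sb p - ub p‖ < ε := by
      rw [← dist_eq_norm]
      exact hsb p
    have h2 : |lam p| ≤ 1 := abs_le.2 ⟨by linarith [(hlam01 p).1], (hlam01 p).2⟩
    calc ‖d p‖ = |lam p| * ‖sb p - ub p‖ := by rw [hd, norm_smul, Real.norm_eq_abs]
      _ ≤ 1 * ε := mul_le_mul h2 h1.le (norm_nonneg _) zero_le_one
      _ = ε := one_mul ε
  have hd_zero_off : ∀ p, p ∉ L₂ → d p = 0 := fun p hp => by
    have : lam p = 0 := by
      by_contra h
      exact hp (interior_subset (hlam_supp p h))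
    simp only [hd, this, zero_smul]
  have hd_ev : ∀ p, p ∉ tsupport lam → d =ᶠ[𝓝 p] fun _ => 0 := fun p hp => by
    filter_upwards [notMem_tsupport_iff_eventuallyEq.1 hp] with p' hp'
    simp only [hd, Pi.zero_apply] at hp' ⊢
    rw [hp', zero_smul]
  have hdc : Continuous d := lam.contMDiff.continuous.smul (sb.contMDiff.continuous.sub hubc)
  have hdO : ContMDiffOn IP 𝓘(ℝ, EuclideanSpace ℝ (Fin n)) ∞ d O :=
    lam.contMDiff.contMDiffOn.smul (sb.contMDiff.contMDiffOn.sub hubO)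
  have hdS : ∀ p ∈ S, d p = 0 := fun p hp => by
    simp only [hd, hsbS hp, sub_self, smul_zero]
  -- ### the new map
  set H' : P → N := fun p => if d p = 0 then H p else ψ.symm (ψ (H p) + d p) with hH'
  have htgt : ∀ p ∈ W, ψ (H p) + d p ∈ ψ.target := by
    intro p hp
    by_cases hpL : p ∈ L₂
    · exact hε₀P p hpL _ ((hd_norm p).trans hεle0)
    · rw [hd_zero_off p hpL, add_zero]
      exact ψ.map_source (hWsrc p hp)
  have hformula : ∀ p ∈ W, H' p = ψ.symm (ψ (H p) + d p) := by
    intro p hp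
    by_cases h0 : d p = 0
    · simp only [hH', h0, if_true, add_zero]
      exact (ψ.left_inv (hWsrc p hp)).symm
    · simp only [hH', h0, if_false]
  have hH'eq : ∀ p, p ∉ tsupport lam → H' =ᶠ[𝓝 p] H := by
    intro p hp
    filter_upwards [hd_ev p hp] with p' hp'
    simp only [hH', hp', if_true]
  have hH'c : Continuous H' := by
    rw [continuous_iff_continuousAt]
    intro p
    by_cases hp : p ∈ W
    · have hev : H' =ᶠ[𝓝 p] fun p => ψ.symm (ψ (H p) + d p) := by
        filter_upwards [hWo.mem_nhds hp] with p' hp' using hformula p' hp'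
      refine (continuousAt_congr hev).2 ?_
      have h1 : ContinuousAt (fun p => ψ (H p) + d p) p := (hψH_cont p hp).add hdc.continuousAt
      exact ContinuousAt.comp (continuousAt_extChartAt_symm'' (htgt p hp)) h1
    · have hp' : p ∉ tsupport lam := fun h => hp (hL₂W (htsupp_lam h))
      exact (continuousAt_congr (hH'eq p hp')).2 hH.continuousAt
  have hψsymm : ∀ y ∈ ψ.target,
      ContMDiffAt 𝓘(ℝ, EuclideanSpace ℝ (Fin n)) (𝓡 n) ∞ ψ.symm y := fun y hy =>
    (contMDiffOn_extChartAt_symm x).contMDiffAt ((isOpen_extChartAt_target x).mem_nhds hy)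
  refine ⟨H', hH'c, ⟨O ∪ interior L₁, hO.union isOpen_interior, union_subset_union hSO hKL₁,
    ?_⟩, fun p hp => ?_, fun i p hpC => ?_⟩
  · -- ### smoothness on `O ∪ L₁°`
    intro p hp
    refine ContMDiffAt.contMDiffWithinAt ?_
    rcases hp with hpO | hpL
    · by_cases hpW : p ∈ W
      · have hev : H' =ᶠ[𝓝 p] fun p => ψ.symm (ψ (H p) + d p) := by
          filter_upwards [hWo.mem_nhds hpW] with p' hp' using hformula p' hp'
        refine ContMDiffAt.congr_of_eventuallyEq ?_ hev
        have h1 : ContMDiffAt IP 𝓘(ℝ, EuclideanSpace ℝ (Fin n)) ∞ (fun p => ψ (H p) + d p) p :=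
          (hψH_smooth p ⟨hpO, hpW⟩).add (hdO.contMDiffAt (hO.mem_nhds hpO))
        exact (hψsymm _ (htgt p hpW)).comp p h1
      · have hp' : p ∉ tsupport lam := fun h => hpW (hL₂W (htsupp_lam h))
        exact (hHO.contMDiffAt (hO.mem_nhds hpO)).congr_of_eventuallyEq (hH'eq p hp')
    · -- near `K`: `H' = ψ⁻¹ ∘ sb`
      have hid : ∀ p' ∈ interior L₁, ψ (H p') + d p' = sb p' := by
        intro p' hp'
        have h1 : lam p' = 1 := hlam1 (interior_subset hp')
        have h2 : chi p' = 1 := hchi1 (interior_subset (hL₁L₂ (interior_subset hp')))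
        simp only [hd, hub, h1, h2, one_smul]
        abel
      have hev : H' =ᶠ[𝓝 p] fun p => ψ.symm (sb p) := by
        filter_upwards [isOpen_interior.mem_nhds hpL] with p' hp'
        rw [hformula p' (hL₁W (interior_subset hp')), hid p' hp']
      refine ContMDiffAt.congr_of_eventuallyEq ?_ hev
      have hsbp : sb p ∈ ψ.target := by
        rw [← hid p hpL]
        exact htgt p (hL₁W (interior_subset hpL))
      exact (hψsymm _ hsbp).comp p sb.contMDiff.contMDiffAt
  · -- ### `H' = H` on `S`
    simp only [hH', hdS p hp, if_true]
  · -- ### the constraints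
    by_cases h0 : d p = 0
    · simp only [hH', h0, if_true]
      exact hCU i hpC
    · have hlam : lam p ≠ 0 := fun h => h0 (by simp only [hd, h, zero_smul])
      have hpL₂ : p ∈ L₂ := interior_subset (hlam_supp p hlam)
      have hpW : p ∈ W := hL₂W hpL₂
      obtain ⟨-, hyU⟩ := hεiP i p ⟨hpC, hpL₂⟩ (d p) ((hd_norm p).trans (hεlei i))
      rw [hformula p hpW]
      exact hyU

end Step

/-! ### Finitely many charts: relative smoothing on a compact set -/

section Compact

variable [IsManifold (𝓡 n) ∞ N]
  {EP HP : Type*} [NormedAddCommGroup EP] [NormedSpace ℝ EP] [FiniteDimensional ℝ EP]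
  [TopologicalSpace HP] {IP : ModelWithCorners ℝ EP HP}
  {P : Type*} [TopologicalSpace P] [ChartedSpace HP P] [IsManifold IP ∞ P]
  [SigmaCompactSpace P] [T2Space P]

/-- **Relative smoothing on a compact set** (Milnor (1965), Lemma 6.11; Hirsch (1976), Ch. 2
Thm. 2.6).  Let `H : P → N` be continuous and `C^∞` on an open set `O` containing the closed set
`S`, let `K ⊆ P` be compact, and let finitely many compact sets `C i` be mapped by `H` into open
sets `U i`.  Then there is a continuous `H' : P → N`, `C^∞` on an open set containing `S ∪ K`,
equal to `H` on `S` and mapping each `C i` into `U i`.  Proof: cover `K` by finitely many compact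
neighbourhoods mapped into chart sources of `N` and apply `exists_smoothing_step` once for each,
carrying the chart conditions of the remaining pieces along as constraints.
[cite: MilnorHCobordism1965, Lemma 6.11 (PDF p. 42)] -/
theorem exists_contMDiffOn_of_isCompact {H : P → N} (hH : Continuous H) {O : Set P}
    (hO : IsOpen O) (hHO : ContMDiffOn IP (𝓡 n) ∞ H O) {S : Set P} (hS : IsClosed S)
    (hSO : S ⊆ O) {K : Set P} (hK : IsCompact K)
    {ι : Type*} [Finite ι] {C : ι → Set P} {U : ι → Set N} (hC : ∀ i, IsCompact (C i))
    (hU : ∀ i, IsOpen (U i)) (hCU : ∀ i, MapsTo H (C i) (U i)) :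
    ∃ H' : P → N, Continuous H' ∧
      (∃ O' : Set P, IsOpen O' ∧ S ∪ K ⊆ O' ∧ ContMDiffOn IP (𝓡 n) ∞ H' O') ∧
      EqOn H' H S ∧ ∀ i, MapsTo H' (C i) (U i) := by
  classical
  haveI : LocallyCompactSpace P := Manifold.locallyCompact_of_finiteDimensional IP
  -- ### compact neighbourhoods mapped into chart sources
  have hnb : ∀ p : P, ∃ Kp : Set P, IsCompact Kp ∧ Kp ∈ 𝓝 p ∧
      MapsTo H Kp (chartAt (EuclideanSpace ℝ (Fin n)) (H p)).source := by
    intro p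
    have hWo : IsOpen (H ⁻¹' (chartAt (EuclideanSpace ℝ (Fin n)) (H p)).source) :=
      (chartAt (EuclideanSpace ℝ (Fin n)) (H p)).open_source.preimage hH
    obtain ⟨L, hLc, hpL, hLW⟩ := exists_compact_between isCompact_singleton hWo
      (singleton_subset_iff.2 (mem_chart_source _ (H p)))
    exact ⟨L, hLc, mem_interior_iff_mem_nhds.1 (hpL (mem_singleton p)), fun q hq => hLW hq⟩
  choose Kp hKpc hKpn hKpsrc using hnb
  obtain ⟨t, -, htK⟩ := hK.elim_nhds_subcover Kp fun p _ => hKpn p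
  -- ### the extended family of constraints
  set C' : ι ⊕ (t : Set P) → Set P := Sum.elim C fun p => Kp p with hC'
  set U' : ι ⊕ (t : Set P) → Set N :=
    Sum.elim U fun p => (chartAt (EuclideanSpace ℝ (Fin n)) (H p)).source with hU'
  have hC'c : ∀ j, IsCompact (C' j) := by
    rintro (i | p)
    · exact hC i
    · exact hKpc p
  have hU'o : ∀ j, IsOpen (U' j) := by
    rintro (i | p)
    · exact hU i
    · exact (chartAt (EuclideanSpace ℝ (Fin n)) (H p)).open_source
  have hCU' : ∀ j, MapsTo H (C' j) (U' j) := by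
    rintro (i | p)
    · exact hCU i
    · exact hKpsrc p
  -- ### induction over the pieces
  have hind : ∀ s : Finset P, s ⊆ t → ∃ G : P → N, Continuous G ∧
      (∃ O' : Set P, IsOpen O' ∧ (S ∪ ⋃ p ∈ s, Kp p) ⊆ O' ∧ ContMDiffOn IP (𝓡 n) ∞ G O') ∧
      EqOn G H S ∧ ∀ j, MapsTo G (C' j) (U' j) := by
    intro s
    induction s using Finset.induction_on with
    | empty =>
      intro _
      refine ⟨H, hH, ⟨O, hO, ?_, hHO⟩, fun _ _ => rfl, hCU'⟩
      simpa using hSO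
    | @insert p s hps ih =>
      intro hst
      obtain ⟨G, hGc, ⟨O₁, hO₁, hSO₁, hGO₁⟩, hGS, hGCU⟩ :=
        ih ((Finset.subset_insert _ _).trans hst)
      have hpt : p ∈ (t : Set P) := hst (Finset.mem_insert_self _ _)
      have hS₁ : IsClosed (S ∪ ⋃ q ∈ s, Kp q) :=
        hS.union (isClosed_biUnion_finset fun q _ => (hKpc q).isClosed)
      have hKx : MapsTo G (Kp p) (chartAt (EuclideanSpace ℝ (Fin n)) (H p)).source :=
        hGCU (Sum.inr ⟨p, hpt⟩)
      obtain ⟨G', hG'c, ⟨O₂, hO₂, hSO₂, hG'O₂⟩, hG'S, hG'CU⟩ :=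
        exists_smoothing_step hGc hO₁ hGO₁ hS₁ hSO₁ (hKpc p) hKx hC'c hU'o hGCU
      refine ⟨G', hG'c, ⟨O₂, hO₂, ?_, hG'O₂⟩, fun q hq => (hG'S (Or.inl hq)).trans (hGS hq),
        hG'CU⟩
      intro q hq
      apply hSO₂
      rw [Finset.set_biUnion_insert] at hq
      rcases hq with hq | hq | hq
      · exact Or.inl (Or.inl hq)
      · exact Or.inr hq
      · exact Or.inl (Or.inr hq)
  obtain ⟨G, hGc, ⟨O', hO', hSO', hGO'⟩, hGS, hGCU⟩ := hind t (Finset.Subset.refl t)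
  refine ⟨G, hGc, ⟨O', hO', ?_, hGO'⟩, hGS, fun i => hGCU (Sum.inl i)⟩
  exact union_subset (fun q hq => hSO' (Or.inl hq)) (fun q hq => hSO' (Or.inr (htK hq)))

end Compact

/-! ### Smoothing a homotopy rel ends, non-compact target -/

section Homotopy

variable [IsManifold (𝓡 n) ∞ N]

/-- **Smoothing a homotopy rel ends** (Milnor (1965), Lemma 6.11; Hirsch (1976), Ch. 2 Thm. 2.6
with Ch. 8 §1: *homotopic smooth maps are smoothly homotopic*).  Let `M` be a compact
Hausdorff `C^∞` manifold (model with corners `IM` on a finite-dimensional space), `N` a `C^∞`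
manifold modelled on `ℝⁿ` (not necessarily compact), and `e₀ e₁ : C(M, N)` smooth maps,
homotopic as continuous maps.  Then there is a smooth `H : ℝ × M → N` with `H (t, ·) = e₀` for
`t ≤ 1/4` and `H (t, ·) = e₁` for `t ≥ 3/4`: reparametrise the homotopy to be `e₀` for
`t ≤ 1/3` and `e₁` for `t ≥ 2/3` and smooth it chart by chart on the compact set
`[1/4, 3/4] × M` relative to the closed set `{t ≤ 1/4} ∪ {t ≥ 3/4}`
(`exists_contMDiffOn_of_isCompact`). [cite: MilnorHCobordism1965, Lemma 6.11 (PDF p. 42)] -/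
theorem exists_contMDiff_homotopy_of_homotopic_chartwise {EM HM : Type*} [NormedAddCommGroup EM]
    [NormedSpace ℝ EM] [FiniteDimensional ℝ EM] [TopologicalSpace HM]
    {IM : ModelWithCorners ℝ EM HM} {M : Type*} [TopologicalSpace M] [ChartedSpace HM M]
    [IsManifold IM ∞ M] [CompactSpace M] [T2Space M]
    {e₀ e₁ : C(M, N)} (he₀ : ContMDiff IM (𝓡 n) ∞ e₀) (he₁ : ContMDiff IM (𝓡 n) ∞ e₁)
    (h : e₀.Homotopic e₁) :
    ∃ H : ℝ × M → N, ContMDiff (𝓘(ℝ, ℝ).prod IM) (𝓡 n) ∞ H ∧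
      (∀ t : ℝ, t ≤ 1 / 4 → ∀ u, H (t, u) = e₀ u) ∧ (∀ t : ℝ, 3 / 4 ≤ t → ∀ u, H (t, u) = e₁ u) := by
  obtain ⟨F⟩ := h
  -- ### the reparametrised continuous homotopy
  set σ : ℝ → unitInterval := fun t => Set.projIcc 0 1 zero_le_one (3 * t - 1) with hσ
  have hσc : Continuous σ := continuous_projIcc.comp (by fun_prop)
  have hσ0 : ∀ t : ℝ, t ≤ 1 / 3 → σ t = 0 := fun t ht => by
    change Set.projIcc 0 1 zero_le_one (3 * t - 1) = 0
    rw [Set.projIcc_of_le_left _ (by linarith)]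
    rfl
  have hσ1 : ∀ t : ℝ, 2 / 3 ≤ t → σ t = 1 := fun t ht => by
    change Set.projIcc 0 1 zero_le_one (3 * t - 1) = 1
    rw [Set.projIcc_of_right_le _ (by linarith)]
    rfl
  set g₀ : ℝ × M → N := fun p => F (σ p.1, p.2) with hg₀
  have hg₀c : Continuous g₀ :=
    F.continuous.comp ((hσc.comp continuous_fst).prodMk continuous_snd)
  have hg₀0 : ∀ p : ℝ × M, p.1 ≤ 1 / 3 → g₀ p = e₀ p.2 := fun p hp => by
    rw [hg₀]
    dsimp only
    rw [hσ0 p.1 hp]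
    exact F.apply_zero p.2
  have hg₀1 : ∀ p : ℝ × M, 2 / 3 ≤ p.1 → g₀ p = e₁ p.2 := fun p hp => by
    rw [hg₀]
    dsimp only
    rw [hσ1 p.1 hp]
    exact F.apply_one p.2
  -- ### `g₀` is smooth near the closed set of end times
  set S : Set (ℝ × M) := {p | p.1 ≤ 1 / 4 ∨ 3 / 4 ≤ p.1} with hS
  set U : Set (ℝ × M) := {p | p.1 < 1 / 3 ∨ 2 / 3 < p.1} with hU
  have hSc : IsClosed S :=
    (isClosed_le continuous_fst continuous_const).union (isClosed_le continuous_const continuous_fst)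
  have hUo : IsOpen U :=
    (isOpen_lt continuous_fst continuous_const).union (isOpen_lt continuous_const continuous_fst)
  have hSU : S ⊆ U := fun p hp => hp.imp (fun h => by linarith) (fun h => by linarith)
  have hg₀U : ContMDiffOn (𝓘(ℝ, ℝ).prod IM) (𝓡 n) ∞ g₀ U := by
    intro p hp
    rcases hp with hp | hp
    · have hev : g₀ =ᶠ[𝓝 p] fun p : ℝ × M => e₀ p.2 := by
        filter_upwards [(isOpen_lt continuous_fst continuous_const).mem_nhds hp] with p' hp'
        exact hg₀0 p' (le_of_lt hp')
      exact (((he₀.comp contMDiff_snd).contMDiffAt).congr_of_eventuallyEq hev).contMDiffWithinAt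
    · have hev : g₀ =ᶠ[𝓝 p] fun p : ℝ × M => e₁ p.2 := by
        filter_upwards [(isOpen_lt continuous_const continuous_fst).mem_nhds hp] with p' hp'
        exact hg₀1 p' (le_of_lt hp')
      exact (((he₁.comp contMDiff_snd).contMDiffAt).congr_of_eventuallyEq hev).contMDiffWithinAt
  -- ### chartwise smoothing on the compact set `[1/4, 3/4] × M`
  have hK : IsCompact (Icc (1 / 4 : ℝ) (3 / 4) ×ˢ (univ : Set M)) :=
    isCompact_Icc.prod isCompact_univ
  obtain ⟨H, -, ⟨O', -, hSO', hHO'⟩, hHS, -⟩ := exists_contMDiffOn_of_isCompact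
    (IP := 𝓘(ℝ, ℝ).prod IM) hg₀c hUo hg₀U hSc hSU hK (ι := Empty)
    (C := fun i => i.elim) (U := fun i => i.elim) (fun i => i.elim) (fun i => i.elim)
    (fun i => i.elim)
  have hcov : ∀ p : ℝ × M, p ∈ O' := by
    intro p
    apply hSO'
    by_cases hp : p.1 ∈ Icc (1 / 4 : ℝ) (3 / 4)
    · exact Or.inr ⟨hp, mem_univ _⟩
    · rw [mem_Icc, not_and_or, not_le, not_le] at hp
      exact Or.inl (hp.imp le_of_lt le_of_lt)
  have hHs : ContMDiff (𝓘(ℝ, ℝ).prod IM) (𝓡 n) ∞ H := fun p =>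
    (hHO' p (hcov p)).contMDiffAt (Filter.univ_mem' hcov)
  refine ⟨H, hHs, fun t ht u => ?_, fun t ht u => ?_⟩
  · have hS' : ((t, u) : ℝ × M) ∈ S := Or.inl ht
    rw [hHS hS']
    exact hg₀0 (t, u) (by change t ≤ 1 / 3; linarith)
  · have hS' : ((t, u) : ℝ × M) ∈ S := Or.inr ht
    rw [hHS hS']
    exact hg₀1 (t, u) (by change 2 / 3 ≤ t; linarith)

end Homotopy

end Literature.Topology.FourManifolds
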